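import Summits.BirchSwinnertonDyer.BirchSwinnertonDyer.Theorems.PrintCf2RubinValueTwoZetaSpanOfRayClassNorm
import Summits.BirchSwinnertonDyer.BirchSwinnertonDyer.Theorems.PrintCf2RubinValueTwoIdealPeriodLattices
import Summits.BirchSwinnertonDyer.BirchSwinnertonDyer.Theorems.PrintCf2RubinValueTwoTwistedKummerEulerStep
import HarnessLib

/-!
# KATO DOCKING for case (c) of (LZ): the class over `F_m ⊔ K(𝔤₁)` of a root of the canonical theta value `Θ(1; 𝔤₁, 𝔤)` corestricts INTO
# `proj_{n,k}(Λ₂ · _𝔤ζ)` when every prime of `p𝔣` divides `𝔤₁ ∣ p^s𝔣` (`𝔤₁` rigid, `𝔤` Kato-admissible)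

Cell `bsd-print-cf2`, WIDTH seat `bsd-line-cf2-p1-w5` g11 (prover-bsd-line-cf2-p1-w5-g11-0); piece (c-C) of case (c) (the displayed input (G1-M-c) of
`hG1M_of_cases` / `hZC_of_inputs`) of the (LZ) blueprint behind hZC on the DECIDING child stmt-BirchSwinnertonDyer-24721; `--supports` 24721 (helper,
Theses-free). THEOREMS ONLY (no definition, no named fact, no instance, no `sorry`); CONDITIONAL on the prints `DeShalit1987.prop25_i_normRelation`,
`DeShalit1987.prop24_i_mem_rayClassField` (hypotheses). HONEST FRAMING: bookkeeping over the pins of ty2's `TwistedIwasawaData` and -w2 g17's norm chain;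
nothing here closes the crux; no summit statement is proved by this seat; BSD is not proved by any of this.

THE DOCKING. `𝔤` admissible, `𝔤₁ ∣ p^s𝔣` rigid with `supp(𝔤₁) = supp(p𝔣)`, `y₀ ∈ K(𝔤₁)` with `ι̂ y₀ = Θ(1; 𝔤₁, 𝔤)`, `M = F_m ⊔ K(𝔤₁) ⊆ K_s`. Pin (Z1) at a
level `s′ ≥ s` gives a Kato representative `u` with `proj_{n,k}(_𝔤ζ) = cor_{K_{s′}→K̃_n}(c)`, `c` a class of `β`, `β^{p^k} = u⁻¹`; -w2 g17's chain
(every prime of `p^{s′}𝔣/𝔤₁` divides `𝔤₁`; `𝔤₁` rigid) gives **`N_{K_{s′}/K(𝔤₁)}(u¹²) = y₀` exactly**; `N_{K_{s′}/K(𝔤₁)} = N_{M/K(𝔤₁)} ∘ N_{K_{s′}/M}`;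
`cor_{K_{s′}→M}(−12c)` is a class of a root of `v = N_{K_{s′}/M}(u¹²)`; `N_{M/K(𝔤₁)}(v) = ∏ₓ t(x)·v` so a class of a root of `y₀` is
`Σₓ (θ′(t(x)⁻¹) mod p^k)·t(x)·(cor_{K_{s′}→M}(−12c))` (twisted conjugation law + root independence); corestrict to `K̃_n` and use P1.

* `exists_list_primes_mul_prod_eq` — `B ≤ A`, `B ≠ 0`: `A · ∏ l = B` with `l` the prime factors of `A⁻¹B`;
* **`exists_mem_relCores_eq_proj_of_kato_dock`** — the docking: `∃ z ∈ Z, cor_{M→K̃_n}(c₀) = proj_{n,k}(z)` for every class `c₀` over `M` of a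
  root of `y₀`, whenever `_𝔤ζ ∈ Z`.

References: K. Kato (2004) §15.5; E. de Shalit (1987) II.2.4 (i), II.2.5 (i); J. Johnson-Leung, G. Kings (2011) Def. 3.2, Def. 3.5, §5.2, §5.4.
-/

noncomputable section

open scoped Classical

-- the summit namespace `Summit.BirchSwinnertonDyer.BirchSwinnertonDyer` repeats the problem name by design (D-0017)
set_option linter.dupNamespace false
set_option autoImplicit false

open scoped NumberField
open Field IsDedekindDomain IntermediateField
open Literature.NumberTheory.NumberFields (rayClassField rayClassField_mono rayClassField_inf)
open Literature.NumberTheory.GaloisRepresentations Literature.NumberTheory.GaloisRepresentations.DiscreteGaloisModule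
open Literature.NumberTheory.GaloisRepresentations.LocalWeilDatum
open Literature.NumberTheory.EllipticCurves
open Literature.NumberTheory.ComplexMultiplication.EllipticUnits
open Literature.NumberTheory.ComplexMultiplication.EllipticUnits.JohnsonLeungKings2011
open Summit.BirchSwinnertonDyer.BirchSwinnertonDyer.Theorems.PrintCf2
open Summit.BirchSwinnertonDyer.BirchSwinnertonDyer.Theorems.PrintCf2.RowTwo

namespace Summit.BirchSwinnertonDyer.BirchSwinnertonDyer.Theorems.PrintCf2.TwistedZeta

/-! ## §1. Prime factor lists -/

section Ideals

variable {K : Type} [Field K] [NumberField K]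

/-- **`A · ∏ l = B` with `l` a list of non-zero primes all containing `B`**, for ideals `B ≤ A`, `B ≠ 0` of `𝒪_K` (prime factorisation of `A⁻¹B`).
[cite: NeukirchANT1999, Ch. I §3 Thm. (3.3)] -/
theorem exists_list_primes_mul_prod_eq {A B : Ideal (𝓞 K)} (hB : B ≠ ⊥) (hBA : B ≤ A) :
    ∃ l : List (Ideal (𝓞 K)), (∀ I ∈ l, I.IsPrime ∧ I ≠ ⊥ ∧ B ≤ I) ∧ A * l.prod = B := by
  obtain ⟨C, rfl⟩ := Ideal.dvd_iff_le.mpr hBA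
  have hC : C ≠ ⊥ := fun h ↦ hB (by rw [h, Ideal.mul_bot])
  refine ⟨(UniqueFactorizationMonoid.normalizedFactors C).toList, fun I hI ↦ ?_, ?_⟩
  · rw [Multiset.mem_toList] at hI
    have hp := UniqueFactorizationMonoid.prime_of_normalized_factor I hI
    refine ⟨Ideal.isPrime_of_prime hp, hp.ne_zero, Ideal.le_of_dvd ?_⟩
    exact (UniqueFactorizationMonoid.dvd_of_mem_normalizedFactors hI).trans (dvd_mul_left C A)
  · rw [Multiset.prod_toList, Ideal.prod_normalizedFactors_eq_self hC]

end Ideals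

/-! ## §2. A product law for twisted Kummer classes -/

section ProdLaw

variable {K : Type} [Field K] [NumberField K] (p : ℕ) [Fact p.Prime] (S : Set (HeightOneSpectrum (𝓞 K)))
  (θ : absoluteGaloisGroup K →ₜ* ℤ_[p]ˣ) (k : ℕ) (U : Subgroup (absoluteGaloisGroup K))

omit [NumberField K] in
/-- **Product law over a finset**: classes `c i` of `β i` give the class `Σ c i` of `∏ β i`. [cite: JohnsonLeungKings2011, §3.3 (5)–(6) (arXiv p0010:L61–70)] -/
theorem isTwistedKummerClass_finset_prod {α : Type*} (T : Finset α) {β : α → (AlgebraicClosure K)ˣ} {c : α → levelCoh p S θ U k 1}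
    (h : ∀ i ∈ T, IsTwistedKummerClass p θ S U k (β i) (c i)) : IsTwistedKummerClass p θ S U k (∏ i ∈ T, β i) (∑ i ∈ T, c i) := by
  induction T using Finset.induction_on with
  | empty => rw [Finset.prod_empty, Finset.sum_empty]; exact isTwistedKummerClass_zero_one p S θ U k
  | insert a T ha ih =>
    rw [Finset.prod_insert ha, Finset.sum_insert ha]
    exact isTwistedKummerClass_mul p S θ U k (h a (Finset.mem_insert_self a T)) (ih fun i hi ↦ h i (Finset.mem_insert_of_mem hi))

end ProdLaw

/-! ## §3. The docking -/

section Dock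

variable {K : Type} [Field K] [NumberField K] [IsGalois K (AlgebraicClosure K)] {p : ℕ} [Fact p.Prime] (ι : K →+* ℂ)
  (K₀ : IntermediateField K (AlgebraicClosure K)) [FiniteDimensional K K₀] [IsAbelianGalois K K₀]
  {κ₁ κ₂ : ZpExtension K p} {η₁ η₂ : absoluteGaloisGroup K} (θ' : absoluteGaloisGroup K →ₜ* ℤ_[p]ˣ) (𝔣 : Ideal (𝓞 K))
  (D : TwistedIwasawaData p κ₁ κ₂ η₁ η₂ θ' 𝔣 ι)

/-- **KATO DOCKING.** `K` totally complex, `𝔣 ≠ 0`, `θ′|_{Gal(K̄/K₀)} = 1`, generator pair up to units; `𝔞` admissible with `_𝔞ζ ∈ Z`;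
`𝔤₁` rigid, `≠ 1`, with `p^s𝔣 ⊆ 𝔤₁` and every prime of `p𝔣` dividing `𝔤₁`; `F_m ⊆ K(p^s𝔣)`; `y₀` with `ι̂ y₀ = Θ(1; 𝔤₁, 𝔞)` (so `y₀ ∈ K(𝔤₁)`); `c₀` a twisted Kummer
class at `Gal(K̄/F_m ⊔ K(𝔤₁))` of a `p^k`-th root of `y₀`. THEN `cor_{F_mK(𝔤₁)→K̃_n}(c₀) = proj_{n,k}(z)` for some `z ∈ Z` — GIVEN de Shalit II.2.4 (i), II.2.5 (i).
[cite: Kato2004Asterisque, §15.5 (p. 253)] [cite: deShalit1987, II.2.4 Proposition (i) and II.2.5 Proposition (i)] [cite: JohnsonLeungKings2011, Def. 3.2, Def. 3.5, §5.2 and §5.4 (arXiv p0009:L55–70, p0010:L72–80, p0014:L80–99, p0015:L159–161)] -/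
theorem exists_mem_relCores_eq_proj_of_kato_dock [NumberField.IsTotallyComplex K] (h25 : DeShalit1987.prop25_i_normRelation)
    (h24i : DeShalit1987.prop24_i_mem_rayClassField) (hK : IsImaginaryQuadratic K) (h𝔣 : 𝔣 ≠ ⊥)
    (hθ'K₀ : ∀ σ ∈ galFixing K K₀, θ' σ = 1)
    (hγ : ∃ u₁ u₂ : ℤ_[p]ˣ, ZpExtension.IsTopGeneratorPair (κ₁.unitTwist u₁) (κ₂.unitTwist u₂) η₁ η₂)
    {Z : Submodule (IwasawaAlgebra₂ p) D.D1.H} (𝔞 : AuxIdeals p 𝔣) (hZa : D.aZeta 𝔞 ∈ Z)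
    {n k m s : ℕ} {𝔤₁ : Ideal (𝓞 K)} (h𝔤₁s : katoModulus p 𝔣 s ≤ 𝔤₁) (h𝔤₁1 : 𝔤₁ ≠ ⊤) (hrig : UnitsInjectiveMod 𝔤₁)
    (hsupp : ∀ v : HeightOneSpectrum (𝓞 K), v ∈ suppPF p 𝔣 → 𝔤₁ ≤ v.asIdeal)
    (hFs : rubinLayer K₀ κ₁ κ₂ m ≤ katoLayer p 𝔣 s) {y₀ : AlgebraicClosure K}
    (hy₀ : IsThetaValueOne ι 𝔤₁ 𝔞.1 (algClosureEmb ι y₀))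
    (hUo : IsOpen (galFixing K (rubinLayer K₀ κ₁ κ₂ m ⊔ rayClassField K 𝔤₁) : Set (absoluteGaloisGroup K)))
    (hUle : galFixing K (rubinLayer K₀ κ₁ κ₂ m ⊔ rayClassField K 𝔤₁) ≤ JohnsonLeungKings2011.pairLayerSubgroup κ₁ κ₂ n)
    {y₀u β₀ : (AlgebraicClosure K)ˣ} (hy₀u : (y₀u : AlgebraicClosure K) = y₀) (hβ₀ : β₀ ^ (p ^ k) = y₀u)
    {c₀ : levelCoh p (suppPF p 𝔣) θ' (galFixing K (rubinLayer K₀ κ₁ κ₂ m ⊔ rayClassField K 𝔤₁)) k 1}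
    (hc₀ : IsTwistedKummerClass p θ' (suppPF p 𝔣) (galFixing K (rubinLayer K₀ κ₁ κ₂ m ⊔ rayClassField K 𝔤₁)) k β₀ c₀) :
    ∃ z ∈ Z, relCores p (suppPF p 𝔣) θ' hUle (JohnsonLeungKings2011.isOpen_pairLayerSubgroup κ₁ κ₂ n) hUo k 1 c₀ = D.D1.proj n k z := by
  have hp : p.Prime := Fact.out
  haveI : FiniteDimensional K (rubinLayer K₀ κ₁ κ₂ m) := LeopoldtAtV.finiteDimensional_rubinLayer K₀ κ₁ κ₂ m
  haveI : IsAbelianGalois K (rubinLayer K₀ κ₁ κ₂ m) := LeopoldtAtV.isAbelianGalois_rubinLayer K₀ κ₁ κ₂ m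
  haveI : FiniteDimensional K ↥((rubinLayer K₀ κ₁ κ₂ m) ⊔ (rayClassField K 𝔤₁)) := IntermediateField.finiteDimensional_sup (rubinLayer K₀ κ₁ κ₂ m) (rayClassField K 𝔤₁)
  haveI : IsAbelianGalois K ↥((rubinLayer K₀ κ₁ κ₂ m) ⊔ (rayClassField K 𝔤₁)) := LeopoldtAtV.isAbelianGalois_sup (rubinLayer K₀ κ₁ κ₂ m) (rayClassField K 𝔤₁)
  haveI : (galFixing K ((rubinLayer K₀ κ₁ κ₂ m) ⊔ (rayClassField K 𝔤₁))).Normal := normal_galFixing _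
  have hSp : ∀ v : HeightOneSpectrum (𝓞 K), ((p : ℕ) : 𝓞 K) ∈ v.asIdeal → v ∈ suppPF p 𝔣 :=
    fun v hv ↦ dvd_mul_of_dvd_left (Ideal.dvd_span_singleton.mpr hv) 𝔣
  have hμN : ∀ τ ∈ ramificationSubgroup K (suppPF p 𝔣), ∀ ξ : (AlgebraicClosure K)ˣ, ξ ^ (p ^ k) = 1 → τ • ξ = ξ :=
    fun _ hτ ξ hξ ↦ smul_eq_self_of_mem_ramificationSubgroup_of_units_pow_eq_one p (suppPF p 𝔣) k hSp hτ ξ hξ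
  have h𝔤₁0 : 𝔤₁ ≠ ⊥ := fun h ↦ katoModulus_ne_bot p 𝔣 h𝔣 s (le_bot_iff.mp (h ▸ h𝔤₁s))
  have hE₁M : (rayClassField K 𝔤₁) ≤ (rubinLayer K₀ κ₁ κ₂ m) ⊔ (rayClassField K 𝔤₁) := le_sup_right
  have hFM : galFixing K ((rubinLayer K₀ κ₁ κ₂ m) ⊔ (rayClassField K 𝔤₁)) ≤ galFixing K (rubinLayer K₀ κ₁ κ₂ m) := galFixing_antitone K le_sup_left
  have hθM : ∀ σ ∈ galFixing K ((rubinLayer K₀ κ₁ κ₂ m) ⊔ (rayClassField K 𝔤₁)), θ' σ = 1 := fun σ hσ ↦ hθ'K₀ σ (galFixing_antitone K (le_rubinLayer K₀ κ₁ κ₂ m) (hFM hσ))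
  -- the Kato level `s' = s + s₀ + 1` and pin (Z1)
  obtain ⟨s₀, hs₀⟩ := D.aZeta_proj 𝔞 n k
  set s' : ℕ := s + s₀ + 1 with hs'
  have hss' : s ≤ s' := by omega
  have hE₁s' : (rayClassField K 𝔤₁) ≤ katoLayer p 𝔣 s' := rayClassField_mono (rayUnitIdeles_anti_of_le (katoModulus_ne_bot p 𝔣 h𝔣 s')
    ((katoModulus_anti p 𝔣 hss').trans h𝔤₁s))
  have hMs' : (rubinLayer K₀ κ₁ κ₂ m) ⊔ (rayClassField K 𝔤₁) ≤ katoLayer p 𝔣 s' := sup_le (hFs.trans (katoLayer_mono p 𝔣 h𝔣 hss')) hE₁s'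
  have hUs'M : katoLevelSubgroup p 𝔣 s' ≤ galFixing K ((rubinLayer K₀ κ₁ κ₂ m) ⊔ (rayClassField K 𝔤₁)) :=
    (KatoPUnits.katoLevelSubgroup_eq_galFixing p 𝔣 s').le.trans (galFixing_antitone K hMs')
  have hle' : katoLevelSubgroup p 𝔣 s' ≤ JohnsonLeungKings2011.pairLayerSubgroup κ₁ κ₂ n := hUs'M.trans hUle
  have hNs' : ramificationSubgroup K (suppPF p 𝔣) ≤ katoLevelSubgroup p 𝔣 s' := ramificationSubgroup_suppPF_le_katoLevelSubgroup p 𝔣 h𝔣 s'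
  have hNM : ramificationSubgroup K (suppPF p 𝔣) ≤ galFixing K ((rubinLayer K₀ κ₁ κ₂ m) ⊔ (rayClassField K 𝔤₁)) := hNs'.trans hUs'M
  have hθN : ∀ τ ∈ ramificationSubgroup K (suppPF p 𝔣), θ' τ = 1 := fun τ hτ ↦ hθM τ (hNM hτ)
  have hθs' : ∀ σ ∈ katoLevelSubgroup p 𝔣 s', θ' σ = 1 := fun σ hσ ↦ hθM σ (hUs'M hσ)
  have hUs'o : IsOpen (katoLevelSubgroup p 𝔣 s' : Set (absoluteGaloisGroup K)) := isOpen_absGaloisFixingSubgroup K (katoLayer p 𝔣 s')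
  obtain ⟨u, β, c, hu, hβ, hc, hproj⟩ := hs₀ s' (by omega) hle'
  have huK : (u : AlgebraicClosure K) ∈ katoLayer p 𝔣 s' := hu.1.1
  -- `p^{s'}𝔣 = 𝔤₁ · ∏ l` with `l ≠ []` primes dividing `𝔤₁`
  obtain ⟨l, hl, hprod⟩ := exists_list_primes_mul_prod_eq (katoModulus_ne_bot p 𝔣 h𝔣 s') ((katoModulus_anti p 𝔣 hss').trans h𝔤₁s)
  have hl0 : l ≠ [] := by
    intro hl0
    rw [hl0, List.prod_nil, mul_one] at hprod
    have h1 : katoModulus p 𝔣 (s + s₀ + 1) ≤ katoModulus p 𝔣 (s + s₀) := katoModulus_anti p 𝔣 (Nat.le_succ _)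
    have h2 : katoModulus p 𝔣 (s + s₀) ≤ katoModulus p 𝔣 (s + s₀ + 1) := (katoModulus_anti p 𝔣 (by omega : s ≤ s + s₀)).trans (hprod ▸ h𝔤₁s)
    have h3 : katoModulus p 𝔣 (s + s₀) * Ideal.span {((p : ℕ) : 𝓞 K)} = katoModulus p 𝔣 (s + s₀) * 1 := by
      rw [mul_one, ← KatoUnitRepNorm.katoModulus_succ_eq]; exact le_antisymm h1 h2
    have h4 := mul_left_cancel₀ (katoModulus_ne_bot p 𝔣 h𝔣 (s + s₀)) h3
    have hp1 : (Ideal.span {((p : ℕ) : 𝓞 K)} : Ideal (𝓞 K)) ≠ ⊤ := by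
      have h := katoModulus_ne_top p (⊤ : Ideal (𝓞 K)) (le_refl 1)
      rwa [katoModulus_one, Ideal.mul_top] at h
    exact hp1 (h4.trans Ideal.one_eq_top)
  -- period-pair data at `𝔤₁` and at `p^{s'}𝔣 = 𝔤₁ · ∏ l`
  obtain ⟨P, Pa, T, hP, hPa, hT, hy₀Θ⟩ := hy₀
  obtain ⟨P', Pa', T', hP', hPa', hT', hθu⟩ := hu.2
  have hP'' : ∀ z : ℂ, z ∈ P'.lattice ↔ ∃ a ∈ 𝔤₁ * l.prod, z = ι (a : K) := by rw [hprod]; exact hP'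
  have h𝔞0 : 𝔞.1 ≠ ⊥ := ne_bot_of_isCoprime_katoModulus p 𝔣 (𝔞.2.isCoprime_katoModulus_one p 𝔣)
  have h𝔞c : IsCoprime 𝔞.1 (𝔤₁ * l.prod) := by rw [hprod]; exact 𝔞.2.isCoprime_katoModulus p 𝔣 s'
  have hprimes : ∀ I ∈ l, I.IsPrime ∧ I ≠ ⊥ := fun I hI ↦ ⟨(hl I hI).1, (hl I hI).2.1⟩
  have hdvd : ∀ I ∈ l, I ∣ 𝔤₁ := by
    intro I hI
    obtain ⟨hIp, hI0, hIle⟩ := hl I hI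
    let v : HeightOneSpectrum (𝓞 K) := ⟨I, hIp, hI0⟩
    have hvS : v ∈ suppPF p 𝔣 := by
      change I ∣ Ideal.span {((p : ℕ) : 𝓞 K)} * 𝔣
      rw [katoModulus] at hIle
      refine Ideal.dvd_iff_le.mpr ?_
      rcases (Ideal.IsPrime.mul_le hIp).mp hIle with h1 | h1
      · exact Ideal.mul_le_right.trans ((Ideal.IsPrime.pow_le_iff (hP := hIp) (by omega : s' ≠ 0)).mp h1)
      · exact Ideal.mul_le_left.trans h1
    exact Ideal.dvd_iff_le.mpr (hsupp v hvS)
  have huz : ((u : AlgebraicClosure K) ^ 12) ∈ rayClassField K (𝔤₁ * l.prod) := by rw [hprod]; exact pow_mem huK 12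
  have hchain := KatoThetaNorm.algClosureEmb_normOver_chain h25 h24i hK ι l hl0 hprimes h𝔤₁0 h𝔤₁1 hrig hdvd h𝔞0 h𝔞c hP hPa hT
    hP'' hPa' hT' huz hθu
  -- `N_{K_{s'}/K(𝔤₁)}(u¹²) = y₀`
  haveI : FiniteDimensional K ↥(katoLayer p 𝔣 s') := inferInstance
  haveI : IsAbelianGalois K ↥(katoLayer p 𝔣 s') := inferInstance
  have hu12K : ((u : AlgebraicClosure K) ^ 12) ∈ katoLayer p 𝔣 s' := pow_mem huK 12
  have hNy₀ : ((normOver (katoLayer p 𝔣 s') (rayClassField K 𝔤₁) ⟨(u : AlgebraicClosure K) ^ 12, hu12K⟩ : katoLayer p 𝔣 s') : AlgebraicClosure K) = y₀ := by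
    apply (algClosureEmb ι).injective
    rw [hy₀Θ, ← hchain]
    congr 1
    exact KatoThetaNorm.coe_normOver_congr (congrArg (rayClassField K) hprod.symm) rfl _ _
  -- through `M = (rubinLayer K₀ κ₁ κ₂ m) ⊔ (rayClassField K 𝔤₁)`: `y₀ = N_{M/(rayClassField K 𝔤₁)}(v)`, `v = N_{K_{s'}/M}(u¹²)`
  set v : AlgebraicClosure K :=
    ((normOver (katoLayer p 𝔣 s') ((rubinLayer K₀ κ₁ κ₂ m) ⊔ (rayClassField K 𝔤₁)) ⟨(u : AlgebraicClosure K) ^ 12, hu12K⟩ : katoLayer p 𝔣 s') : AlgebraicClosure K) with hv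
  have hvM : v ∈ (rubinLayer K₀ κ₁ κ₂ m) ⊔ (rayClassField K 𝔤₁) := LeopoldtAtV.coe_normOver_mem hMs' _
  have hy₀v : y₀ = ((normOver ((rubinLayer K₀ κ₁ κ₂ m) ⊔ (rayClassField K 𝔤₁)) (rayClassField K 𝔤₁) ⟨v, hvM⟩ : ↥((rubinLayer K₀ κ₁ κ₂ m) ⊔ (rayClassField K 𝔤₁))) : AlgebraicClosure K) := by
    rw [← hNy₀]
    exact (LeopoldtAtV.coe_normOver_normOver hE₁M hMs' ⟨_, hu12K⟩).symm
  -- the class `c_v = cor_{U_{s'}→M}(12·(−c))` of `β_v = ∏ₓ s(x)·β⁻¹²`, `β_v^{p^k} = v`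
  haveI : (katoLevelSubgroup p 𝔣 s').FiniteIndex := finiteIndex_of_isOpen' hUs'o
  letI : Fintype (↥(galFixing K ((rubinLayer K₀ κ₁ κ₂ m) ⊔ (rayClassField K 𝔤₁))) ⧸ (katoLevelSubgroup p 𝔣 s').subgroupOf (galFixing K ((rubinLayer K₀ κ₁ κ₂ m) ⊔ (rayClassField K 𝔤₁)))) := Fintype.ofFinite _
  let sM : ↥(galFixing K ((rubinLayer K₀ κ₁ κ₂ m) ⊔ (rayClassField K 𝔤₁))) ⧸ (katoLevelSubgroup p 𝔣 s').subgroupOf (galFixing K ((rubinLayer K₀ κ₁ κ₂ m) ⊔ (rayClassField K 𝔤₁))) → ↥(galFixing K ((rubinLayer K₀ κ₁ κ₂ m) ⊔ (rayClassField K 𝔤₁))) :=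
    fun x ↦ Quotient.out x
  have hsM : ∀ x, (sM x : ↥(galFixing K ((rubinLayer K₀ κ₁ κ₂ m) ⊔ (rayClassField K 𝔤₁))) ⧸ (katoLevelSubgroup p 𝔣 s').subgroupOf (galFixing K ((rubinLayer K₀ κ₁ κ₂ m) ⊔ (rayClassField K 𝔤₁)))) = x :=
    fun x ↦ QuotientGroup.out_eq' x
  have hcneg : IsTwistedKummerClass p θ' (suppPF p 𝔣) (katoLevelSubgroup p 𝔣 s') k (β⁻¹ ^ 12) ((12 : ℕ) • (-c)) :=
    isTwistedKummerClass_pow p (suppPF p 𝔣) θ' k _ (isTwistedKummerClass_inv p (suppPF p 𝔣) θ' k _ hc) 12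
  set cv := relCores p (suppPF p 𝔣) θ' hUs'M hUo hUs'o k 1 ((12 : ℕ) • (-c)) with hcvdef
  set βv : (AlgebraicClosure K)ˣ := ∏ x, ((sM x : galFixing K ((rubinLayer K₀ κ₁ κ₂ m) ⊔ (rayClassField K 𝔤₁))) : absoluteGaloisGroup K) • (β⁻¹ ^ 12) with hβv
  have hcv : IsTwistedKummerClass p θ' (suppPF p 𝔣) (galFixing K ((rubinLayer K₀ κ₁ κ₂ m) ⊔ (rayClassField K 𝔤₁))) k βv cv :=
    isTwistedKummerClass_relCores p (suppPF p 𝔣) θ' k hUs'M hUo hUs'o hNs' hθM hsM hcneg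
  have hβu12 : (β⁻¹ ^ 12) ^ (p ^ k) = u ^ 12 := by rw [← pow_mul, mul_comm, pow_mul, inv_pow, hβ, inv_inv]
  have hβvval : (((βv ^ (p ^ k) : (AlgebraicClosure K)ˣ)) : AlgebraicClosure K) = v := by
    rw [hβv, ← Finset.prod_pow, Units.coe_prod, hv,
      ← prod_smul_eq_normOver_of_eq hMs' rfl (KatoPUnits.katoLevelSubgroup_eq_galFixing p 𝔣 s') hsM ⟨_, hu12K⟩]
    refine Finset.prod_congr rfl fun x _ ↦ ?_
    rw [← smul_pow', hβu12, Units.coe_smul, Units.val_pow_eq_pow_val]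
  have hβvN : ∀ ρ ∈ ramificationSubgroup K (suppPF p 𝔣), ρ • βv = βv := smul_eq_self_of_isTwistedKummerClass p θ' hNM hcv
  have hvkM : (((βv ^ (p ^ k) : (AlgebraicClosure K)ˣ)) : AlgebraicClosure K) ∈ (rubinLayer K₀ κ₁ κ₂ m) ⊔ (rayClassField K 𝔤₁) := by rw [hβvval]; exact hvM
  -- `y₀ = N_{M/(rayClassField K 𝔤₁)}(v) = ∏ₓ t(x)·v` over representatives `t` of `Gal(K̄/(rayClassField K 𝔤₁))/Gal(K̄/M)`
  haveI : (galFixing K ((rubinLayer K₀ κ₁ κ₂ m) ⊔ (rayClassField K 𝔤₁))).FiniteIndex := finiteIndex_of_isOpen' hUo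
  letI : Fintype (↥(galFixing K (rayClassField K 𝔤₁)) ⧸ (galFixing K ((rubinLayer K₀ κ₁ κ₂ m) ⊔ (rayClassField K 𝔤₁))).subgroupOf (galFixing K (rayClassField K 𝔤₁))) := Fintype.ofFinite _
  let t : ↥(galFixing K (rayClassField K 𝔤₁)) ⧸ (galFixing K ((rubinLayer K₀ κ₁ κ₂ m) ⊔ (rayClassField K 𝔤₁))).subgroupOf (galFixing K (rayClassField K 𝔤₁)) → ↥(galFixing K (rayClassField K 𝔤₁)) := fun x ↦ Quotient.out x
  have ht : ∀ x, (t x : ↥(galFixing K (rayClassField K 𝔤₁)) ⧸ (galFixing K ((rubinLayer K₀ κ₁ κ₂ m) ⊔ (rayClassField K 𝔤₁))).subgroupOf (galFixing K (rayClassField K 𝔤₁))) = x := fun x ↦ QuotientGroup.out_eq' x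
  have hy₀prod : y₀ = ∏ x, ((t x : galFixing K (rayClassField K 𝔤₁)) : absoluteGaloisGroup K) • v := by
    rw [hy₀v]; exact (prod_smul_eq_normOver_of_eq hE₁M rfl rfl ht ⟨v, hvM⟩).symm
  -- classes `cx x` of `t(x)·β_v` and the conjugation law
  have hex : ∀ x, ∃ cx : levelCoh p (suppPF p 𝔣) θ' (galFixing K ((rubinLayer K₀ κ₁ κ₂ m) ⊔ (rayClassField K 𝔤₁))) k 1,
      IsTwistedKummerClass p θ' (suppPF p 𝔣) (galFixing K ((rubinLayer K₀ κ₁ κ₂ m) ⊔ (rayClassField K 𝔤₁))) k (((t x : galFixing K (rayClassField K 𝔤₁)) : absoluteGaloisGroup K) • βv) cx := by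
    intro x
    refine exists_isTwistedKummerClass p (suppPF p 𝔣) θ' k _ hUo hθM hθN hμN _
      (smul_smul_eq_of_mem_normal (ramificationSubgroup K (suppPF p 𝔣)) hβvN _) fun σ hσ ↦ ?_
    have hmem : ((t x : galFixing K (rayClassField K 𝔤₁)) : absoluteGaloisGroup K) • (((βv ^ (p ^ k) : (AlgebraicClosure K)ˣ)) : AlgebraicClosure K) ∈ (rubinLayer K₀ κ₁ κ₂ m) ⊔ (rayClassField K 𝔤₁) := by
      rw [LeopoldtAtV.smul_coe_eq_restrictNormal ((rubinLayer K₀ κ₁ κ₂ m) ⊔ (rayClassField K 𝔤₁)) _ ⟨_, hvkM⟩]; exact SetLike.coe_mem _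
    have hfix : σ • (((t x : galFixing K (rayClassField K 𝔤₁)) : absoluteGaloisGroup K) • (βv ^ (p ^ k))) =
        ((t x : galFixing K (rayClassField K 𝔤₁)) : absoluteGaloisGroup K) • (βv ^ (p ^ k)) :=
      Units.ext (by rw [Units.coe_smul, Units.coe_smul]; exact (mem_galFixing_iff K).mp hσ _ hmem)
    rw [div_pow, ← smul_pow', ← smul_pow', hfix, div_self']
  choose cx hcx using hex
  have hcanc : ∀ x, (charModPow p θ' k (((t x : galFixing K (rayClassField K 𝔤₁)) : absoluteGaloisGroup K))⁻¹).val •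
      levelConj p (suppPF p 𝔣) θ' (galFixing K ((rubinLayer K₀ κ₁ κ₂ m) ⊔ (rayClassField K 𝔤₁))) k 1 ((t x : galFixing K (rayClassField K 𝔤₁)) : absoluteGaloisGroup K) cv = cx x := by
    intro x
    rw [levelConj_eq_nsmul_of_isTwistedKummerClass p (suppPF p 𝔣) θ' (galFixing K ((rubinLayer K₀ κ₁ κ₂ m) ⊔ (rayClassField K 𝔤₁))) k hcv _ (hcx x), ← mul_nsmul', ← natCast_zsmul,
      Nat.cast_mul, charModPow_apply, charModPow_apply, map_inv]
    exact zsmul_val_inv_mul_val_eq_self p k (nsmul_levelCoh_one_eq_zero p (suppPF p 𝔣) θ' (galFixing K ((rubinLayer K₀ κ₁ κ₂ m) ⊔ (rayClassField K 𝔤₁))) k _) (θ' _)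
  -- `c₀ = Σₓ cx x`
  have hsum : IsTwistedKummerClass p θ' (suppPF p 𝔣) (galFixing K ((rubinLayer K₀ κ₁ κ₂ m) ⊔ (rayClassField K 𝔤₁))) k
      (∏ x, ((t x : galFixing K (rayClassField K 𝔤₁)) : absoluteGaloisGroup K) • βv) (∑ x, cx x) :=
    isTwistedKummerClass_finset_prod p (suppPF p 𝔣) θ' k _ Finset.univ fun x _ ↦ hcx x
  have hpow : (∏ x, ((t x : galFixing K (rayClassField K 𝔤₁)) : absoluteGaloisGroup K) • βv) ^ (p ^ k) = β₀ ^ (p ^ k) := by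
    apply Units.ext
    rw [hβ₀, hy₀u, hy₀prod, ← Finset.prod_pow, Units.coe_prod]
    refine Finset.prod_congr rfl fun x _ ↦ ?_
    rw [← smul_pow', Units.coe_smul, hβvval]
  have hc₀eq : c₀ = ∑ x, cx x := eq_of_isTwistedKummerClass_of_pow_eq p (suppPF p 𝔣) θ' k _ hθM hθN hμN hpow hc₀ hsum
  -- corestrict to `K̃_n`: `cor c_v = −12·proj(_𝔞ζ)`, `cor` commutes with `t(x)·`, and `t(x)·` is a `Λ₂`-element (P1)
  let cor : levelCoh p (suppPF p 𝔣) θ' (galFixing K ((rubinLayer K₀ κ₁ κ₂ m) ⊔ (rayClassField K 𝔤₁))) k 1 →+ layerCoh p κ₁ κ₂ θ' 𝔣 n k 1 :=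
    relCores p (suppPF p 𝔣) θ' hUle (JohnsonLeungKings2011.isOpen_pairLayerSubgroup κ₁ κ₂ n) hUo k 1
  have hcorcv : cor cv = D.D1.proj n k ((12 : ℕ) • -D.aZeta 𝔞) := by
    have e1 : cor cv = relCores p (suppPF p 𝔣) θ' hle' (JohnsonLeungKings2011.isOpen_pairLayerSubgroup κ₁ κ₂ n) hUs'o k 1 ((12 : ℕ) • (-c)) :=
      relCores_relCores_one p (suppPF p 𝔣) θ' hUs'M hUle (JohnsonLeungKings2011.isOpen_pairLayerSubgroup κ₁ κ₂ n) hUo hUs'o k _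
    rw [e1, map_nsmul, map_neg, ← hproj, map_nsmul, map_neg]
  have hZ' : (12 : ℕ) • -D.aZeta 𝔞 ∈ Z := Z.toAddSubgroup.nsmul_mem (Z.neg_mem hZa) 12
  have hzx : ∀ x, ∃ z ∈ Z, ∀ k', D.D1.proj n k' z =
      layerConj p κ₁ κ₂ θ' 𝔣 n k' 1 ((t x : galFixing K (rayClassField K 𝔤₁)) : absoluteGaloisGroup K) (D.D1.proj n k' ((12 : ℕ) • -D.aZeta 𝔞)) :=
    fun x ↦ exists_mem_proj_eq_layerConj D.D1 (by norm_num : 1 ≤ 2) hγ _ n Z hZ'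
  choose zx hzxZ hzx using hzx
  refine ⟨∑ x, (charModPow p θ' k (((t x : galFixing K (rayClassField K 𝔤₁)) : absoluteGaloisGroup K))⁻¹).val • zx x,
    Z.sum_mem fun x _ ↦ Z.toAddSubgroup.nsmul_mem (hzxZ x) _, ?_⟩
  change cor c₀ = _
  rw [hc₀eq, map_sum, map_sum]
  refine Finset.sum_congr rfl fun x _ ↦ ?_
  rw [← hcanc x, map_nsmul, map_nsmul, hzx x k, ← hcorcv]
  congr 1
  exact (layerConj_relCores p κ₁ κ₂ θ' 𝔣 n k hUo hUle _ cv).symm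

end Dock

end Summit.BirchSwinnertonDyer.BirchSwinnertonDyer.Theorems.PrintCf2.TwistedZeta

end
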